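import Summits.Ventures.PercRepro.C025ProfileThinGirthA

/-!
# THE ROW `(q, q+1)` ON THIN MATROIDS WITH A `g`-CIRCUIT — part B: (Dem) (night-3 g15)
The `g`-circuit generalisation of `C025ProfileThinTriangleB` (part A = `C025ProfileThinGirthA`; `ThinTriangle.dem_a` is reused as it
stands): the demand side for an ABSTRACT weight `w`, in the thin regime. `dem_top`: an independent `q`-set with `g − 1` points of `C₀`
(written `K` below, `|K| = g`, `ρ(K) + 1 = g`) has the missing point `k` of `C₀` as its unique inner point and pays `s_I` on `B ∪ {x}`
and `s_Q` on `B ∪ {k, x}` for the `|E| − q − 1` points `x ∉ B ∪ {k}`. `dem_small` / `dem_small_inner`: an independent `q`-set with `m` points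
of `C₀` pays `a` / `b` on `B ∪ {x}` according to `x ∈ C₀` / `x ∉ C₀` — for every `x ∉ B` when it has no inner point, and for every
`x ∉ B ∪ {y}` when it has the inner point `y`, plus `σ` on each of the `|E| − q − 1` sets `B ∪ {y, x}` (`m ≤ g − 2`; the number `j` of
`C₀`-points among the `x` is `g − m` or `g − 1 − m`, according to `y ∉ C₀` / `y ∈ C₀`).
-/
open scoped Matroid
namespace PercRepro
open Set Finset ThmH Staged
namespace ThinGirth
variable {α : Type} [DecidableEq α] {M : Matroid α} [M.Finite]

/-- **(Dem), the top type** (`|B| = q`, `ρ(B) = q`, `|B ∩ C₀| = g − 1`): the missing point `k` of `C₀` is the unique inner point; `B ∪ {x}`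
and `B ∪ {k, x}` (`x ∉ B ∪ {k}`) have rank `q + 1` and carry `s_I` and `s_Q`; `f (s_I + s_Q) ≥ f + 1 ≥ ρ(E ∖ B)` with `f = |E| − q − 1`. -/
theorem dem_top {q g : ℕ} {K : Finset α} (hKg : K ⊆ gr M) (hK3 : K.card = g) (hKrk : rkN M K + 1 = g)
    (hthin : ∀ X ⊆ gr M, rkN M X = q → X.card ≤ q + 1)
    (w : Finset α → Finset α → ℚ) (hw_nonneg : ∀ B S, 0 ≤ w B S) (sI sQ : ℚ)
    (hw_2I : ∀ B S : Finset α, B.card = q → (B ∩ K).card + 1 = g → S.card = q + 1 → w B S = sI)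
    (hw_2Q : ∀ B S : Finset α, B.card = q → (B ∩ K).card + 1 = g → S.card = q + 2 → (S ∩ K).card = g → w B S = sQ)
    (hdem : (((gr M).card - q - 1 : ℕ) : ℚ) + 1 ≤ (((gr M).card - q - 1 : ℕ) : ℚ) * (sI + sQ))
    {B : Finset α} (hBg : B ⊆ gr M) (hBc : B.card = q) (hB : rkN M B = q) (hBK : (B ∩ K).card + 1 = g) :
    (crk M B : ℚ) ≤ ∑ S ∈ (Shadow.levelSet M (q + 1)).filter (fun S => B ⊆ S), w B S := by
  have hKB1 : (K \ B).card = 1 := by have := OneCircuit.card_sdiff_add_card_inter' K B; omega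
  obtain ⟨y, hy⟩ := Finset.card_eq_one.mp hKB1
  have hyK : y ∈ K := (Finset.mem_sdiff.mp (hy ▸ Finset.mem_singleton_self y)).1
  have hyB : y ∉ B := (Finset.mem_sdiff.mp (hy ▸ Finset.mem_singleton_self y)).2
  have hyg : y ∈ gr M := hKg hyK
  have hyr : rkN M (insert y B) = q := rkN_insert_eq_of_top hK3 hKrk hBc hB hBK hyK hyB
  set T := (gr M \ B).erase y with hT
  have hTx : ∀ x ∈ T, x ∉ B := fun x hx => (Finset.mem_sdiff.mp (Finset.mem_of_mem_erase hx)).2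
  have hTy : ∀ x ∈ T, x ≠ y := fun x hx => Finset.ne_of_mem_erase hx
  have hTg : ∀ x ∈ T, x ∈ gr M := fun x hx => (Finset.mem_sdiff.mp (Finset.mem_of_mem_erase hx)).1
  have hTcard : T.card = (gr M).card - q - 1 := by
    rw [hT, Finset.card_erase_of_mem (Finset.mem_sdiff.mpr ⟨hyg, hyB⟩), Finset.card_sdiff_of_subset hBg, hBc]
  -- the sets `B ∪ {x}` have rank `q + 1`: `x ≠ y` is not an inner point
  have hr1 : ∀ x ∈ T, rkN M (insert x B) = q + 1 := by
    intro x hx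
    apply ThinTriangle.rkN_insert_eq_succ_of_ne hB
    intro h
    exact hTy x hx (ThinTriangle.inner_unique hthin hBg hBc hB (hTg x hx) (hTx x hx) hyg hyB h hyr)
  have hmem1 : ∀ x ∈ T, insert x B ∈ Shadow.levelSet M (q + 1) := fun x hx =>
    OneCircuit.mem_levelSet_of_rkN (Finset.insert_subset (hTg x hx) hBg) (hr1 x hx)
  -- the sets `B ∪ {y, x}`
  have hyB' : ∀ x ∈ T, x ∉ insert y B := by
    intro x hx h
    rw [Finset.mem_insert] at h
    rcases h with h | h
    · exact hTy x hx h
    · exact hTx x hx h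
  have hKS2 : ∀ x ∈ T, K ⊆ insert x (insert y B) := by
    intro x _ k hk
    by_cases hkB : k ∈ B
    · exact Finset.mem_insert_of_mem (Finset.mem_insert_of_mem hkB)
    · have : k ∈ K \ B := Finset.mem_sdiff.mpr ⟨hk, hkB⟩
      rw [hy, Finset.mem_singleton] at this
      rw [this]; exact Finset.mem_insert_of_mem (Finset.mem_insert_self y B)
  have hc2 : ∀ x ∈ T, (insert x (insert y B)).card = q + 2 := by
    intro x hx
    rw [Finset.card_insert_of_notMem (hyB' x hx), Finset.card_insert_of_notMem hyB, hBc]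
  have hmem2 : ∀ x ∈ T, insert x (insert y B) ∈ Shadow.levelSet M (q + 1) := by
    intro x hx
    have hsub : insert x (insert y B) ⊆ gr M := Finset.insert_subset (hTg x hx) (Finset.insert_subset hyg hBg)
    exact OneCircuit.mem_levelSet_of_rkN hsub (ThinTriangle.rkN_insert_insert_eq_succ hyr (hr1 x hx))
  set rng := (Shadow.levelSet M (q + 1)).filter (fun S => B ⊆ S) with hrng
  set img1 := T.image (fun x => insert x B) with himg1
  set img2 := T.image (fun x => insert x (insert y B)) with himg2
  have hinj1 : Set.InjOn (fun x => insert x B) (T : Set α) := by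
    intro x hx x' _ hEq
    exact (Finset.insert_inj (hTx x hx)).mp hEq
  have hinj2 : Set.InjOn (fun x => insert x (insert y B)) (T : Set α) := by
    intro x hx x' _ hEq
    exact (Finset.insert_inj (hyB' x hx)).mp hEq
  have hsub1 : img1 ⊆ rng := by
    intro S hS
    rw [himg1, Finset.mem_image] at hS
    obtain ⟨x, hx, rfl⟩ := hS
    rw [hrng, Finset.mem_filter]
    exact ⟨hmem1 x hx, Finset.subset_insert _ _⟩
  have hsub2 : img2 ⊆ rng := by
    intro S hS
    rw [himg2, Finset.mem_image] at hS
    obtain ⟨x, hx, rfl⟩ := hS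
    rw [hrng, Finset.mem_filter]
    exact ⟨hmem2 x hx, (Finset.subset_insert y B).trans (Finset.subset_insert _ _)⟩
  have hdisj : Disjoint img1 img2 := by
    rw [Finset.disjoint_left]
    intro S h1 h2
    rw [himg1, Finset.mem_image] at h1
    rw [himg2, Finset.mem_image] at h2
    obtain ⟨x, hx, rfl⟩ := h1
    obtain ⟨x', hx', hEq⟩ := h2
    have e1 : (insert x B).card = q + 1 := by rw [Finset.card_insert_of_notMem (hTx x hx), hBc]
    have e2 := hc2 x' hx'
    rw [hEq] at e2
    omega
  have hunion : img1 ∪ img2 ⊆ rng := Finset.union_subset hsub1 hsub2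
  have hle : ∑ S ∈ img1 ∪ img2, w B S ≤ ∑ S ∈ rng, w B S :=
    Finset.sum_le_sum_of_subset_of_nonneg hunion (fun S _ _ => hw_nonneg B S)
  rw [Finset.sum_union hdisj] at hle
  have e1 : ∑ S ∈ img1, w B S = (T.card : ℚ) * sI := by
    rw [himg1, Finset.sum_image hinj1]
    rw [Finset.sum_congr rfl (fun x hx => hw_2I B (insert x B) hBc hBK
      (by rw [Finset.card_insert_of_notMem (hTx x hx), hBc]))]
    rw [Finset.sum_const, nsmul_eq_mul]
  have e2 : ∑ S ∈ img2, w B S = (T.card : ℚ) * sQ := by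
    rw [himg2, Finset.sum_image hinj2]
    rw [Finset.sum_congr rfl (fun x hx => hw_2Q B (insert x (insert y B)) hBc hBK (hc2 x hx)
      ((subset_iff_card_inter_eq hK3).mp (hKS2 x hx)))]
    rw [Finset.sum_const, nsmul_eq_mul]
  have h3 : crk M B ≤ (gr M).card - q - 1 + 1 := by
    have := OneCircuit.crk_add_card_le B hBg
    have hn : q + 1 ≤ (gr M).card := by
      have := Finset.card_le_card (Finset.insert_subset hyg hBg)
      rw [Finset.card_insert_of_notMem hyB, hBc] at this
      exact this
    omega
  have h4 : (crk M B : ℚ) ≤ (((gr M).card - q - 1 : ℕ) : ℚ) + 1 := by exact_mod_cast h3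
  rw [hTcard] at e1 e2
  linarith

/-- **(Dem), the lower types without an inner point** (`|B| = q`, `ρ(B) = q`, `|B ∩ C₀| = m`, every `x ∉ B` raises the rank): the sum
over `x ↦ B ∪ {x}`, `x ∈ E ∖ B`, split by `x ∈ C₀`: `(g − m) a + (|E| − q − (g − m)) b` (`a` for `x ∈ C₀`, `b` for `x ∉ C₀`). -/
theorem dem_small {q g : ℕ} {K : Finset α} (hKg : K ⊆ gr M) (hK3 : K.card = g)
    (w : Finset α → Finset α → ℚ) (hw_nonneg : ∀ B S, 0 ≤ w B S) (a b : ℚ) {m : ℕ} (hm : m ≤ g)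
    (hwa : ∀ B S : Finset α, B.card = q → (B ∩ K).card = m → S.card = q + 1 → (S ∩ K).card = m + 1 → w B S = a)
    (hwb : ∀ B S : Finset α, B.card = q → (B ∩ K).card = m → S.card = q + 1 → (S ∩ K).card = m → w B S = b)
    {B : Finset α} (hBg : B ⊆ gr M) (hBc : B.card = q) (hB : rkN M B = q) (hBK : (B ∩ K).card = m)
    (hnoinner : ∀ x ∈ gr M, x ∉ B → rkN M (insert x B) ≠ q) :
    (((g - m : ℕ) : ℚ) * a + (((gr M).card - q - (g - m) : ℕ) : ℚ) * b) ≤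
      ∑ S ∈ (Shadow.levelSet M (q + 1)).filter (fun S => B ⊆ S), w B S := by
  set T := gr M \ B with hT
  have hTx : ∀ x ∈ T, x ∉ B := fun x hx => (Finset.mem_sdiff.mp hx).2
  have hTg : ∀ x ∈ T, x ∈ gr M := fun x hx => (Finset.mem_sdiff.mp hx).1
  have hTcard : T.card = (gr M).card - q := by rw [hT, Finset.card_sdiff_of_subset hBg, hBc]
  have hTK : (T ∩ K).card = g - m := by
    rw [hT, OneCircuit.sdiff_inter_eq_sdiff hKg]
    have := OneCircuit.card_sdiff_add_card_inter' K B
    omega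
  have hTK' : (T \ K).card = (gr M).card - q - (g - m) := by
    have := Finset.card_sdiff_add_card_inter T K
    omega
  have hinter : ∀ x ∈ T, ((insert x B) ∩ K).card = if x ∈ K then m + 1 else m := by
    intro x hx
    split_ifs with hxK
    · rw [Finset.insert_inter_of_mem hxK,
        Finset.card_insert_of_notMem (fun h => hTx x hx (Finset.mem_inter.mp h).1), hBK]
    · rw [Finset.insert_inter_of_notMem hxK, hBK]
  have hmem : ∀ x ∈ T, insert x B ∈ Shadow.levelSet M (q + 1) := fun x hx =>
    OneCircuit.mem_levelSet_of_rkN (Finset.insert_subset (hTg x hx) hBg)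
      (ThinTriangle.rkN_insert_eq_succ_of_ne hB (hnoinner x (hTg x hx) (hTx x hx)))
  have h1 := OneCircuit.sum_insert_le_sum_filter (M := M) (q := q) w (fun S => hw_nonneg B S) T hTx hmem
  have h2 : ∑ x ∈ T, w B (insert x B) = ∑ x ∈ T, (if x ∈ K then a else b) := by
    apply Finset.sum_congr rfl
    intro x hx
    have hc : (insert x B).card = q + 1 := by rw [Finset.card_insert_of_notMem (hTx x hx), hBc]
    have hi := hinter x hx
    split_ifs with hxK
    · rw [if_pos hxK] at hi; exact hwa B _ hBc hBK hc hi
    · rw [if_neg hxK] at hi; exact hwb B _ hBc hBK hc hi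
  rw [h2, OneCircuit.sum_ite_mem_eq, hTK, hTK'] at h1
  exact h1

/-- **(Dem), the lower types with an inner point `y`** (`|B| = q`, `ρ(B) = q`, `|B ∩ C₀| = m ≤ g − 2`, `ρ(B ∪ {y}) = q`): for the
`f = |E| − q − 1` points `x ∉ B ∪ {y}` the sets `B ∪ {x}` have rank `q + 1` and carry `a` / `b` by `x ∈ C₀` / `x ∉ C₀`, and the sets
`B ∪ {y, x}` have rank `q + 1` and carry `σ`; with `j = |C₀ ∖ (B ∪ {y})|` (`g − 1 − m ≤ j ≤ g − m`) the total is `j a + (f − j) b + f σ`. -/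
theorem dem_small_inner {q g : ℕ} {K : Finset α} (hKg : K ⊆ gr M) (hK3 : K.card = g)
    (hthin : ∀ X ⊆ gr M, rkN M X = q → X.card ≤ q + 1)
    (w : Finset α → Finset α → ℚ) (hw_nonneg : ∀ B S, 0 ≤ w B S) (a b σ : ℚ) {m : ℕ} (hm : m + 2 ≤ g)
    (hwa : ∀ B S : Finset α, B.card = q → (B ∩ K).card = m → S.card = q + 1 → (S ∩ K).card = m + 1 → w B S = a)
    (hwb : ∀ B S : Finset α, B.card = q → (B ∩ K).card = m → S.card = q + 1 → (S ∩ K).card = m → w B S = b)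
    (hwσ : ∀ B S : Finset α, B.card = q → (B ∩ K).card + 2 ≤ g → S.card = q + 2 →
      (∃ y ∈ S \ B, rkN M (insert y B) = q) → w B S = σ)
    {B : Finset α} (hBg : B ⊆ gr M) (hBc : B.card = q) (hB : rkN M B = q) (hBK : (B ∩ K).card = m)
    {y : α} (hyg : y ∈ gr M) (hyB : y ∉ B) (hy : rkN M (insert y B) = q) :
    ∃ j : ℕ, j + m ≤ g ∧ g ≤ j + m + 1 ∧
      (j : ℚ) * a + (((gr M).card - q - 1 - j : ℕ) : ℚ) * b + (((gr M).card - q - 1 : ℕ) : ℚ) * σ ≤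
        ∑ S ∈ (Shadow.levelSet M (q + 1)).filter (fun S => B ⊆ S), w B S := by
  set T := (gr M \ B).erase y with hT
  have hTx : ∀ x ∈ T, x ∉ B := fun x hx => (Finset.mem_sdiff.mp (Finset.mem_of_mem_erase hx)).2
  have hTy : ∀ x ∈ T, x ≠ y := fun x hx => Finset.ne_of_mem_erase hx
  have hTg : ∀ x ∈ T, x ∈ gr M := fun x hx => (Finset.mem_sdiff.mp (Finset.mem_of_mem_erase hx)).1
  have hTcard : T.card = (gr M).card - q - 1 := by
    rw [hT, Finset.card_erase_of_mem (Finset.mem_sdiff.mpr ⟨hyg, hyB⟩), Finset.card_sdiff_of_subset hBg, hBc]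
  -- `T ∩ K = (K ∖ B) ∖ {y}`
  have hTK : T ∩ K = (K \ B).erase y := by
    rw [hT, ← OneCircuit.sdiff_inter_eq_sdiff hKg]
    ext z
    simp only [Finset.mem_inter, Finset.mem_erase, Finset.mem_sdiff]
    tauto
  have hKB : (K \ B).card = g - m := by have := OneCircuit.card_sdiff_add_card_inter' K B; omega
  have hj1 : (T ∩ K).card + m ≤ g := by
    rw [hTK]
    have := Finset.card_le_card (Finset.erase_subset y (K \ B))
    omega
  have hj2 : g ≤ (T ∩ K).card + m + 1 := by
    rw [hTK]
    have := Finset.card_erase_le (s := K \ B) (a := y)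
    have h2 := Finset.pred_card_le_card_erase (s := K \ B) (a := y)
    omega
  have hTK' : (T \ K).card = (gr M).card - q - 1 - (T ∩ K).card := by
    have := Finset.card_sdiff_add_card_inter T K
    omega
  have hinter : ∀ x ∈ T, ((insert x B) ∩ K).card = if x ∈ K then m + 1 else m := by
    intro x hx
    split_ifs with hxK
    · rw [Finset.insert_inter_of_mem hxK,
        Finset.card_insert_of_notMem (fun h => hTx x hx (Finset.mem_inter.mp h).1), hBK]
    · rw [Finset.insert_inter_of_notMem hxK, hBK]
  -- the sets `B ∪ {x}` have rank `q + 1`: `x ≠ y` is not an inner point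
  have hr1 : ∀ x ∈ T, rkN M (insert x B) = q + 1 := by
    intro x hx
    apply ThinTriangle.rkN_insert_eq_succ_of_ne hB
    intro h
    exact hTy x hx (ThinTriangle.inner_unique hthin hBg hBc hB (hTg x hx) (hTx x hx) hyg hyB h hy)
  have hmem1 : ∀ x ∈ T, insert x B ∈ Shadow.levelSet M (q + 1) := fun x hx =>
    OneCircuit.mem_levelSet_of_rkN (Finset.insert_subset (hTg x hx) hBg) (hr1 x hx)
  have hyB' : ∀ x ∈ T, x ∉ insert y B := by
    intro x hx h
    rw [Finset.mem_insert] at h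
    rcases h with h | h
    · exact hTy x hx h
    · exact hTx x hx h
  have hc2 : ∀ x ∈ T, (insert x (insert y B)).card = q + 2 := by
    intro x hx
    rw [Finset.card_insert_of_notMem (hyB' x hx), Finset.card_insert_of_notMem hyB, hBc]
  have hmem2 : ∀ x ∈ T, insert x (insert y B) ∈ Shadow.levelSet M (q + 1) := by
    intro x hx
    have hsub : insert x (insert y B) ⊆ gr M := Finset.insert_subset (hTg x hx) (Finset.insert_subset hyg hBg)
    exact OneCircuit.mem_levelSet_of_rkN hsub (ThinTriangle.rkN_insert_insert_eq_succ hy (hr1 x hx))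
  set rng := (Shadow.levelSet M (q + 1)).filter (fun S => B ⊆ S) with hrng
  set img1 := T.image (fun x => insert x B) with himg1
  set img2 := T.image (fun x => insert x (insert y B)) with himg2
  have hinj1 : Set.InjOn (fun x => insert x B) (T : Set α) := by
    intro x hx x' _ hEq
    exact (Finset.insert_inj (hTx x hx)).mp hEq
  have hinj2 : Set.InjOn (fun x => insert x (insert y B)) (T : Set α) := by
    intro x hx x' _ hEq
    exact (Finset.insert_inj (hyB' x hx)).mp hEq
  have hsub1 : img1 ⊆ rng := by
    intro S hS
    rw [himg1, Finset.mem_image] at hS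
    obtain ⟨x, hx, rfl⟩ := hS
    rw [hrng, Finset.mem_filter]
    exact ⟨hmem1 x hx, Finset.subset_insert _ _⟩
  have hsub2 : img2 ⊆ rng := by
    intro S hS
    rw [himg2, Finset.mem_image] at hS
    obtain ⟨x, hx, rfl⟩ := hS
    rw [hrng, Finset.mem_filter]
    exact ⟨hmem2 x hx, (Finset.subset_insert y B).trans (Finset.subset_insert _ _)⟩
  have hdisj : Disjoint img1 img2 := by
    rw [Finset.disjoint_left]
    intro S h1 h2
    rw [himg1, Finset.mem_image] at h1
    rw [himg2, Finset.mem_image] at h2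
    obtain ⟨x, hx, rfl⟩ := h1
    obtain ⟨x', hx', hEq⟩ := h2
    have e1 : (insert x B).card = q + 1 := by rw [Finset.card_insert_of_notMem (hTx x hx), hBc]
    have e2 := hc2 x' hx'
    rw [hEq] at e2
    omega
  have hunion : img1 ∪ img2 ⊆ rng := Finset.union_subset hsub1 hsub2
  have hle : ∑ S ∈ img1 ∪ img2, w B S ≤ ∑ S ∈ rng, w B S :=
    Finset.sum_le_sum_of_subset_of_nonneg hunion (fun S _ _ => hw_nonneg B S)
  rw [Finset.sum_union hdisj] at hle
  have e1 : ∑ S ∈ img1, w B S = ((T ∩ K).card : ℚ) * a + ((T \ K).card : ℚ) * b := by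
    rw [himg1, Finset.sum_image hinj1, ← OneCircuit.sum_ite_mem_eq]
    apply Finset.sum_congr rfl
    intro x hx
    have hc : (insert x B).card = q + 1 := by rw [Finset.card_insert_of_notMem (hTx x hx), hBc]
    have hi := hinter x hx
    split_ifs with hxK
    · rw [if_pos hxK] at hi; exact hwa B _ hBc hBK hc hi
    · rw [if_neg hxK] at hi; exact hwb B _ hBc hBK hc hi
  have e2 : ∑ S ∈ img2, w B S = (T.card : ℚ) * σ := by
    rw [himg2, Finset.sum_image hinj2]
    rw [Finset.sum_congr rfl (fun x hx => hwσ B (insert x (insert y B)) hBc (by omega) (hc2 x hx)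
      ⟨y, Finset.mem_sdiff.mpr ⟨Finset.mem_insert_of_mem (Finset.mem_insert_self y B), hyB⟩, hy⟩)]
    rw [Finset.sum_const, nsmul_eq_mul]
  refine ⟨(T ∩ K).card, hj1, hj2, ?_⟩
  rw [hTK'] at e1
  rw [hTcard] at e2
  linarith

end ThinGirth
end PercRepro
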